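import Mathlib
import HarnessLib
import Summits.HubbardSuperconductivity.HubbardSuperconductivity.Theorems.KLProgrammeH10TwoPointLimitPerturbedCountDepth
import Summits.HubbardSuperconductivity.HubbardSuperconductivity.Theorems.KLProgrammeH10TwoPointLimitPerturbedCountSymmetry
import Summits.HubbardSuperconductivity.HubbardSuperconductivity.Theorems.KLProgrammeH10TwoPointLimitPerturbedFermiRadiusSecondOrder

/-!
# Route `KLProgramme` — K3 engine child `KLRegimeEngineV17F2` (stmt-HubbardSuperconductivity-20437), stub (b) import ι₂:
# the diagonal function at the FORWARD point ON THE PERTURBED CURVE — `D(θ₁+π) = D′(θ₁+π) = 0`, `D(σ) ≥ h_min·(σ − θ₁ − π)²`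

Cell gate-hubbard-kl, plan g17 (R41)(i) «E1-P2-THIN-COUNT» (seat p4; plan HOME/prover-p4/E1-P2-THIN-COUNT-PLAN.md §Refinement 4, part (F3d′) perturbed twin).
Twin of `BandSectorCounting.diag_ge_sq_forward` (`ThinSectorFoldForwardQuadratic`) for the perturbed level function `h^E` with the anchor offset ON THE CURVE,
`P = p_E(θ₁) = (X_E θ₁, Y_E θ₁)`: the forward configuration `σ = θ₁ + π` has momentum sum `P + 2p_E(θ₁+π) = −P = p_E(θ₁+π)` (`curve_add_pi`, even `δ`), so
`D(θ₁+π) = E(p_E(θ₁+π)) − μ = 0` (the root identity) and `D′(θ₁+π) = 2·∂₃h^E = 0` (the first-order level identity `levelIdentity_one`); on the stratum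
`{|D| ≤ η₀, |D′| ≤ η₁}` one has `D″ ≥ 2h_min` (`diag_key_perturbed`), which contains the window `|σ − θ₁ − π| ≤ m₁` when `A_E·m₁ ≤ η₁`, `A_E·m₁² ≤ η₀`
(`A_E` the bound of `abs_diag_deriv2E_le`).  Hence `h_min·(σ − θ₁ − π)² ≤ D(σ)` there: the forward rows of the thin fold count on the frame curve are `O(1)` each.

* `momE_forward`, `hfunE_diag_forward`, `two_h3E_diag_forward` (the two vanishing statements), `diag_ge_sq_forward_perturbed`.

Everything is PROVED; no definitions.  References: BGM 2006 Lemma 3.1 / App. A2 [cite: BenfattoGiulianiMastropietro2006]; Mastropietro 2008 (14.67) p. 223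
[cite: Mastropietro2008].
-/

noncomputable section

namespace Summit.HubbardSuperconductivity.HubbardSuperconductivity.Theorems.PerturbedFermiCurve

set_option linter.dupNamespace false -- summit = problem name (single-conjunct summit), D-0017

open Real Set
open Literature.MathematicalPhysics.QuantumLattice Literature.MathematicalPhysics.QuantumLattice.BandSectorCounting

/-- Two-sided segment mean-value inequality (private plumbing). [folklore] -/
private theorem abs_sub_le_mul_abs_of_deriv' {f f' : ℝ → ℝ} {C a b : ℝ} (hf : ∀ t, HasDerivAt f (f' t) t)
    (hC : ∀ t ∈ uIcc a b, |f' t| ≤ C) : |f b - f a| ≤ C * |b - a| := by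
  have h := Convex.norm_image_sub_le_of_norm_hasDerivWithin_le (fun t _ => (hf t).hasDerivWithinAt)
    (fun t ht => by rw [Real.norm_eq_abs]; exact hC t ht) (convex_uIcc a b) left_mem_uIcc right_mem_uIcc
  simpa [Real.norm_eq_abs] using h

section Forward

variable {a b : ℝ} (B : BandBounds a b) {δ : (Fin 2 → ℝ) → ℝ} (hδs : ContDiff ℝ 2 δ) (heven : ∀ k, δ (-k) = δ k)
  {κ₀ κ₁ κ₂ μ : ℝ} (hδ : ∀ k : Fin 2 → ℝ, |δ k| ≤ κ₀) (hlo : a ≤ μ - κ₀) (hhi : μ + κ₀ ≤ b)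
  (hκ : ∀ k : Fin 2 → ℝ, ‖fderiv ℝ δ k‖ ≤ κ₁) (hκ₁ : κ₁ < B.Dtmin) (hκ₂ : ∀ k : Fin 2 → ℝ, ‖fderiv ℝ (fderiv ℝ δ) k‖ ≤ κ₂)
  {u : ℝ → ℝ} (hu : ∀ θ, IsBandFermiRadius (μ - δ (u θ • dir θ)) θ (u θ))
include B hδs heven hδ hlo hhi hκ hκ₁ hu

/-- **The forward momentum sum is the antipode of the anchor**: with `P = p_E(θ₁)`, `P + 2p_E(θ₁+π) = p_E(θ₁+π)` as a point of `ℝ²`.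
[cite: BenfattoGiulianiMastropietro2006, App. A2] -/
theorem momE_forward (θ₁ : ℝ) :
    momE u (XE u θ₁, YE u θ₁) (θ₁ + π) (θ₁ + π) = u (θ₁ + π) • dir (θ₁ + π) := by
  have h2ne : (2 : WithTop ℕ∞) ≠ 0 := by norm_num
  have hδ' : ∀ k : Fin 2 → ℝ, (∀ i, |k i| ≤ π) → |δ k| ≤ κ₀ := fun k _ => hδ k
  have hκ' : ∀ k : Fin 2 → ℝ, (∀ i, |k i| ≤ π) → ‖fderiv ℝ δ k‖ ≤ κ₁ := fun k _ => hκ k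
  have hd' : ∀ k : Fin 2 → ℝ, (∀ i, |k i| ≤ π) → DifferentiableAt ℝ δ k := fun k _ => (hδs.differentiable h2ne) k
  obtain ⟨hx, hy, -, -⟩ := curve_add_pi B hδ' hlo hhi hd' hκ' hκ₁ hu heven θ₁
  rw [smul_dir_eq_XE_YE]
  ext i; fin_cases i
  · simp [momE, SXE, hx]
  · simp [momE, SYE, hy]

/-- **The forward point is a zero of the perturbed diagonal function**: `h^E_P(θ₁+π, θ₁+π) = E(p_E(θ₁+π)) − μ = 0` for `P = p_E(θ₁)`.
[cite: BenfattoGiulianiMastropietro2006, App. A2] -/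
theorem hfunE_diag_forward (θ₁ : ℝ) : hfunE δ u μ (XE u θ₁, YE u θ₁) (θ₁ + π) (θ₁ + π) = 0 := by
  have hroot : ∀ ϑ, sqDispersion (u ϑ • dir ϑ) + δ (u ϑ • dir ϑ) = μ := fun ϑ =>
    ((isBandFermiRadius_shifted_iff δ μ ϑ (u ϑ)).1 (hu ϑ)).2
  rw [hfunE_eq_sqDispersion, momE_forward B hδs heven hδ hlo hhi hκ hκ₁ hu, hroot, sub_self]

/-- **The forward point is a critical point of the perturbed diagonal function**: `D′(θ₁+π) = 2·∂₃h^E_P(θ₁+π, θ₁+π) = 0` — the first-order level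
identity along the perturbed curve. [cite: BenfattoGiulianiMastropietro2006, App. A2] -/
theorem two_h3E_diag_forward (θ₁ : ℝ) : 2 * h3E δ u (XE u θ₁, YE u θ₁) (θ₁ + π) (θ₁ + π) = 0 := by
  have h2ne : (2 : WithTop ℕ∞) ≠ 0 := by norm_num
  have hδ' : ∀ k : Fin 2 → ℝ, (∀ i, |k i| ≤ π) → |δ k| ≤ κ₀ := fun k _ => hδ k
  have hκ' : ∀ k : Fin 2 → ℝ, (∀ i, |k i| ≤ π) → ‖fderiv ℝ δ k‖ ≤ κ₁ := fun k _ => hκ k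
  have hd' : ∀ k : Fin 2 → ℝ, (∀ i, |k i| ≤ π) → DifferentiableAt ℝ δ k := fun k _ => (hδs.differentiable h2ne) k
  have hroot : ∀ ϑ, sqDispersion (u ϑ • dir ϑ) + δ (u ϑ • dir ϑ) = μ := fun ϑ =>
    ((isBandFermiRadius_shifted_iff δ μ ϑ (u ϑ)).1 (hu ϑ)).2
  have hu2 : ContDiff ℝ 2 u := contDiff_of_isRoot B hδs h2ne hδ' hlo hhi hκ' hκ₁ hu
  have hlev := levelIdentity_one hδs hu2 hroot (θ₁ + π)
  obtain ⟨hx, hy, -, -⟩ := curve_add_pi B hδ' hlo hhi hd' hκ' hκ₁ hu heven θ₁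
  have hSX : SXE u (XE u θ₁, YE u θ₁) (θ₁ + π) (θ₁ + π) = XE u (θ₁ + π) := by unfold SXE; rw [hx]; ring
  have hSY : SYE u (XE u θ₁, YE u θ₁) (θ₁ + π) (θ₁ + π) = YE u (θ₁ + π) := by unfold SYE; rw [hy]; ring
  unfold h3E
  rw [hSX, hSY, momE_forward B hδs heven hδ hlo hhi hκ hκ₁ hu]
  linear_combination (2 : ℝ) * hlev

include hκ₂ in
/-- **Quadratic growth of the perturbed diagonal function at the forward point**: for `P = p_E(θ₁)`, if `|σ − θ₁ − π| ≤ m₁` with `A_E·m₁ ≤ η₁`,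
`A_E·m₁² ≤ η₀` (`A_E` = the bound of `abs_diag_deriv2E_le`) and the smallness of `diag_key_perturbed`, then `h_min·(σ − θ₁ − π)² ≤ h^E_P(σ, σ)`.
[cite: BenfattoGiulianiMastropietro2006, Lemma 3.1 / App. A2] -/
theorem diag_ge_sq_forward_perturbed {θ₁ σ η₀ η₁ m₁ : ℝ} (hlo' : a ≤ μ - κ₀ - η₀) (hhi' : μ + κ₀ + η₀ ≤ b)
    (hsmall :
      16 * (κ₁ * (π * Real.sqrt 2 + 2 * B.smax) / (B.Dtmin - κ₁)) * ((B.smax + κ₁ * (π * Real.sqrt 2 + 2 * B.smax) / (B.Dtmin - κ₁)) + B.smax) +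
        (16 * (B.smax + κ₁ * (π * Real.sqrt 2 + 2 * B.smax) / (B.Dtmin - κ₁)) ^ 2 + 8 * ((((4 + κ₂) * (B.smax + κ₁ * (π * Real.sqrt 2 + 2 * B.smax) / (B.Dtmin - κ₁)) ^ 2 + (8 + 2 * κ₁) * ((4 + κ₁) * (π * Real.sqrt 2) / (B.Dtmin - κ₁)) + (4 + κ₁) * (π * Real.sqrt 2)) / (B.Dtmin - κ₁)) + 2 * ((4 + κ₁) * (π * Real.sqrt 2) / (B.Dtmin - κ₁)) + π * Real.sqrt 2)) *
          (η₀ / B.Dtmin + 2 * κ₀ / B.Dtmin + B.smax * (B.Cg * (η₁ / 2 / 2 + κ₁ * (B.smax + κ₁ * (π * Real.sqrt 2 + 2 * B.smax) / (B.Dtmin - κ₁)) / 2 + 2 * (κ₁ * (π * Real.sqrt 2 + 2 * B.smax) / (B.Dtmin - κ₁)) + 2 * B.smax * (η₀ / B.Dtmin) + 2 * B.smax * (2 * κ₀ / B.Dtmin)))) +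
        6 * (κ₂ * (B.smax + κ₁ * (π * Real.sqrt 2 + 2 * B.smax) / (B.Dtmin - κ₁)) ^ 2) + 4 * (κ₁ * ((((4 + κ₂) * (B.smax + κ₁ * (π * Real.sqrt 2 + 2 * B.smax) / (B.Dtmin - κ₁)) ^ 2 + (8 + 2 * κ₁) * ((4 + κ₁) * (π * Real.sqrt 2) / (B.Dtmin - κ₁)) + (4 + κ₁) * (π * Real.sqrt 2)) / (B.Dtmin - κ₁)) + 2 * ((4 + κ₁) * (π * Real.sqrt 2) / (B.Dtmin - κ₁)) + π * Real.sqrt 2)) ≤ 2 * B.hmin)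
    (hm : |σ - θ₁ - π| ≤ m₁)
    (hm₁ : (16 * (B.smax + κ₁ * (π * Real.sqrt 2 + 2 * B.smax) / (B.Dtmin - κ₁)) ^ 2 + 8 * ((((4 + κ₂) * (B.smax + κ₁ * (π * Real.sqrt 2 + 2 * B.smax) / (B.Dtmin - κ₁)) ^ 2 + (8 + 2 * κ₁) * ((4 + κ₁) * (π * Real.sqrt 2) / (B.Dtmin - κ₁)) + (4 + κ₁) * (π * Real.sqrt 2)) / (B.Dtmin - κ₁)) + 2 * ((4 + κ₁) * (π * Real.sqrt 2) / (B.Dtmin - κ₁)) + π * Real.sqrt 2) + 4 * (κ₂ * (B.smax + κ₁ * (π * Real.sqrt 2 + 2 * B.smax) / (B.Dtmin - κ₁)) ^ 2) + 2 * (κ₁ * ((((4 + κ₂) * (B.smax + κ₁ * (π * Real.sqrt 2 + 2 * B.smax) / (B.Dtmin - κ₁)) ^ 2 + (8 + 2 * κ₁) * ((4 + κ₁) * (π * Real.sqrt 2) / (B.Dtmin - κ₁)) + (4 + κ₁) * (π * Real.sqrt 2)) / (B.Dtmin - κ₁)) + 2 * ((4 + κ₁) * (π * Real.sqrt 2) /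 (B.Dtmin - κ₁)) + π * Real.sqrt 2))) * m₁ ≤ η₁)
    (hm₁' : (16 * (B.smax + κ₁ * (π * Real.sqrt 2 + 2 * B.smax) / (B.Dtmin - κ₁)) ^ 2 + 8 * ((((4 + κ₂) * (B.smax + κ₁ * (π * Real.sqrt 2 + 2 * B.smax) / (B.Dtmin - κ₁)) ^ 2 + (8 + 2 * κ₁) * ((4 + κ₁) * (π * Real.sqrt 2) / (B.Dtmin - κ₁)) + (4 + κ₁) * (π * Real.sqrt 2)) / (B.Dtmin - κ₁)) + 2 * ((4 + κ₁) * (π * Real.sqrt 2) / (B.Dtmin - κ₁)) + π * Real.sqrt 2) + 4 * (κ₂ * (B.smax + κ₁ * (π * Real.sqrt 2 + 2 * B.smax) / (B.Dtmin - κ₁)) ^ 2) + 2 * (κ₁ * ((((4 + κ₂) * (B.smax + κ₁ * (π * Real.sqrt 2 + 2 * B.smax) / (B.Dtmin - κ₁)) ^ 2 + (8 + 2 * κ₁) * ((4 + κ₁) * (π * Real.sqrt 2) / (B.Dtmin - κ₁)) + (4 + κ₁) * (π * Real.sqrt 2)) / (B.Dtmin - κ₁)) + 2 * ((4 + κ₁)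 * (π * Real.sqrt 2) / (B.Dtmin - κ₁)) + π * Real.sqrt 2))) * m₁ ^ 2 ≤ η₀) :
    B.hmin * (σ - θ₁ - π) ^ 2 ≤ hfunE δ u μ (XE u θ₁, YE u θ₁) σ σ := by
  set P : ℝ × ℝ := (XE u θ₁, YE u θ₁) with hP
  set x₀ := θ₁ + π with hx₀
  set AD := 16 * (B.smax + κ₁ * (π * Real.sqrt 2 + 2 * B.smax) / (B.Dtmin - κ₁)) ^ 2 + 8 * ((((4 + κ₂) * (B.smax + κ₁ * (π * Real.sqrt 2 + 2 * B.smax) / (B.Dtmin - κ₁)) ^ 2 + (8 + 2 * κ₁) * ((4 + κ₁) * (π * Real.sqrt 2) / (B.Dtmin - κ₁)) + (4 + κ₁) * (π * Real.sqrt 2)) / (B.Dtmin - κ₁)) + 2 * ((4 + κ₁) * (π * Real.sqrt 2) / (B.Dtmin - κ₁)) + π * Real.sqrt 2) + 4 * (κ₂ * (B.smax + κ₁ * (π * Real.sqrt 2 + 2 * B.smax) / (B.Dtmin - κ₁)) ^ 2) + 2 * (κ₁ * ((((4 + κ₂) * (B.smax + κ₁ * (π * Real.sqrt 2 + 2 *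 B.smax) / (B.Dtmin - κ₁)) ^ 2 + (8 + 2 * κ₁) * ((4 + κ₁) * (π * Real.sqrt 2) / (B.Dtmin - κ₁)) + (4 + κ₁) * (π * Real.sqrt 2)) / (B.Dtmin - κ₁)) + 2 * ((4 + κ₁) * (π * Real.sqrt 2) / (B.Dtmin - κ₁)) + π * Real.sqrt 2)) with hAD
  have hAD0 : 0 ≤ AD := (abs_nonneg _).trans (abs_diag_deriv2E_le B hδs hδ hlo hhi hκ hκ₁ hκ₂ hu P x₀)
  have hm0 : 0 ≤ m₁ := (abs_nonneg _).trans hm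
  set g : ℝ → ℝ := fun x => hfunE δ u μ P x x with hg
  set g1 : ℝ → ℝ := fun x => 2 * h3E δ u P x x with hg1
  set g2 : ℝ → ℝ := fun x => 8 * (Real.cos (SXE u P x x) * VXE u x ^ 2 + Real.cos (SYE u P x x) * VYE u x ^ 2) +
        4 * (Real.sin (SXE u P x x) * (deriv (deriv u) x * Real.cos x - 2 * deriv u x * Real.sin x - u x * Real.cos x) +
          Real.sin (SYE u P x x) * (deriv (deriv u) x * Real.sin x + 2 * deriv u x * Real.cos x - u x * Real.sin x)) +
        (4 * fderiv ℝ (fderiv ℝ δ) (momE u P x x) ![VXE u x, VYE u x] ![VXE u x, VYE u x] +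
          2 * fderiv ℝ δ (momE u P x x) ![(deriv (deriv u) x * Real.cos x - 2 * deriv u x * Real.sin x - u x * Real.cos x),
            (deriv (deriv u) x * Real.sin x + 2 * deriv u x * Real.cos x - u x * Real.sin x)]) with hg2
  have hgd : ∀ x, HasDerivAt g (g1 x) x := hasDerivAt_hfunE_diagZero B hδs hδ hlo hhi hκ hκ₁ hu P
  have hg1d : ∀ x, HasDerivAt g1 (g2 x) x := hasDerivAt_two_h3E_diag B hδs hδ hlo hhi hκ hκ₁ hu P
  have hg0 : g x₀ = 0 := hfunE_diag_forward B hδs heven hδ hlo hhi hκ hκ₁ hu θ₁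
  have hg10 : g1 x₀ = 0 := two_h3E_diag_forward B hδs heven hδ hlo hhi hκ hκ₁ hu θ₁
  have hg2bd : ∀ x, |g2 x| ≤ AD := fun x => abs_diag_deriv2E_le B hδs hδ hlo hhi hκ hκ₁ hκ₂ hu P x
  have hσ : |σ - x₀| ≤ m₁ := by rw [hx₀, show σ - (θ₁ + π) = σ - θ₁ - π by ring]; exact hm
  have hseg : ∀ z ∈ uIcc x₀ σ, |z - x₀| ≤ m₁ := fun z hz => (abs_sub_left_of_mem_uIcc hz).trans hσ
  have hg1z : ∀ z ∈ uIcc x₀ σ, |g1 z| ≤ AD * m₁ := by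
    intro z hz
    have := abs_sub_le_mul_abs_of_deriv' hg1d (a := x₀) (b := z) (fun t ht => hg2bd t)
    rw [hg10, sub_zero] at this
    exact this.trans (mul_le_mul_of_nonneg_left (hseg z hz) hAD0)
  have hgz : ∀ z ∈ uIcc x₀ σ, |g z| ≤ AD * m₁ ^ 2 := by
    intro z hz
    have hsub : uIcc x₀ z ⊆ uIcc x₀ σ := uIcc_subset_uIcc_left hz
    have := abs_sub_le_mul_abs_of_deriv' hgd (a := x₀) (b := z) (fun t ht => hg1z t (hsub ht))
    rw [hg0, sub_zero] at this
    calc |g z| ≤ AD * m₁ * |z - x₀| := this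
      _ ≤ AD * m₁ * m₁ := mul_le_mul_of_nonneg_left (hseg z hz) (by positivity)
      _ = AD * m₁ ^ 2 := by ring
  have hstrat : ∀ z ∈ uIcc x₀ σ, 2 * B.hmin ≤ g2 z := by
    intro z hz
    exact diag_key_perturbed B hδs hδ hlo hhi hκ hκ₁ hκ₂ hu hlo' hhi' ((hgz z hz).trans hm₁') ((hg1z z hz).trans hm₁) hsmall
  rcases le_total x₀ σ with hle | hle
  · have := quadratic_lower_right hgd hg1d hle (c₂ := 2 * B.hmin) (fun z hz => hstrat z (by rw [uIcc_of_le hle]; exact hz))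
    rw [hg0, hg10, zero_mul, zero_add, zero_add] at this
    rw [show σ - θ₁ - π = σ - x₀ by rw [hx₀]; ring]
    linarith
  · have := quadratic_lower_left hgd hg1d hle (c₂ := 2 * B.hmin) (fun z hz => hstrat z (by rw [uIcc_of_ge hle]; exact hz))
    rw [hg0, hg10, zero_mul, zero_add, zero_add] at this
    rw [show σ - θ₁ - π = σ - x₀ by rw [hx₀]; ring]
    linarith

end Forward

end Summit.HubbardSuperconductivity.HubbardSuperconductivity.Theorems.PerturbedFermiCurve

end
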